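import Literature.Claims.NS.Iotti2025

/-!
# C28b `Iotti2025` — kernel refutation of the device of Lemma 4.1 ((4.7) ⇒ (4.8), print p. 8)

D-0090 NS-CLAIMS sweep, row C28b (arXiv:2503.03991 v1 = Zenodo 14977034; skeleton
`Literature.Claims.NS.Iotti2025`, p477797). Refuter lane: ns-claims-refuter-6 (witness, this file);
cross-checked independently by ns-claims-typist-10's kill candidate (same witness, sha16 d4107af5d0450dc6).

Target: `Literature.Claims.NS.Iotti2025.Step_3b = Device_asPrinted` — the printed inference inside the
proof of Lemma 4.1 (print p. 7–8): «we set ∇p = u × ∇θ (4.3) … Taking the divergence of (4.4), we find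
Δp = ∇θ·ω (4.7) … the method of characteristics guarantees the existence of a solution θ … Consequently …
∇p = u × ∇θ in ℝ³∖Ω_t (4.8)», typed at the grain the sentence uses (fields `v, q, θ` on `ℝ³`, no solution,
no class, no decay) and consumed ON the composition path `claim_of_steps_device` via `step3_of_device`.

Witness: the linear shear `v(x) = (x₁, 0, 0)` (so `curl v ≡ (0, 0, −1) ≠ 0` everywhere), `q(x) = x₀`,
`θ ≡ 0`. The scalar premise (4.7) holds at every point (`Δq = 0 = ⟪∇θ, curl v⟫`); the vector conclusion
(4.8) fails at `x = 0` (`∇q = e₀ ≠ 0 = v × ∇θ`). A scalar identity `div F = div G` does not give `F = G`.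
(The pair `(v, q)` is the `t = 0` slice of the exact Navier–Stokes/Euler solution `u = (x₁ − t, 0, 0)`,
`p = x₀`, any viscosity; the solution-grain `Step_3` carries the Sobolev class and is not touched here.)

[cite: Iotti2025UniformBound, Lemma 4.1, proof, displays (4.3)–(4.8), p. 7–8]

WHAT THIS IS NOT: not a claim about NS regularity or blow-up; not a claim about any author beyond the typed
locator.
-/

set_option linter.dupNamespace false

open Filter Topology
open scoped ContDiff InnerProductSpace RealInnerProductSpace Laplacian

namespace Summit.NavierStokesRegularity.NavierStokesRegularity.Theorems.Iotti2025

open Literature.Analysis.FluidPDE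

noncomputable section

/-- The unit vector `e₀ = (1, 0, 0)` of `ℝ³`. [folklore] -/
def e0 : EuclideanSpace ℝ (Fin 3) := EuclideanSpace.single 0 1

/-- The linear shear `x ↦ x₁ e₀ = (x₁, 0, 0)` bundled as a continuous linear map. [folklore] -/
def shearL : EuclideanSpace ℝ (Fin 3) →L[ℝ] EuclideanSpace ℝ (Fin 3) :=
  (EuclideanSpace.proj (1 : Fin 3)).smulRight e0

/-- The shear velocity field `v(x) = (x₁, 0, 0)`. [folklore] -/
def vShear : EuclideanSpace ℝ (Fin 3) → EuclideanSpace ℝ (Fin 3) := fun x => shearL x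

/-- The linear pressure field `q(x) = x₀`. [folklore] -/
def qLin : EuclideanSpace ℝ (Fin 3) → ℝ := fun x => x 0

/-- `v` is (in particular) `C²`. [folklore] -/
theorem contDiff_vShear : ContDiff ℝ 2 vShear := shearL.contDiff

/-- `Dv(x) = shearL` at every point. [folklore] -/
theorem fderiv_vShear (x : EuclideanSpace ℝ (Fin 3)) : fderiv ℝ vShear x = shearL := shearL.fderiv

/-- Third component of the vorticity of the shear: `(curl v)₂ = ∂₀v₁ − ∂₁v₀ = −1`. [folklore] -/
theorem curl_vShear_two (x : EuclideanSpace ℝ (Fin 3)) : curl vShear x 2 = -1 := by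
  simp [curl, fderiv_vShear, shearL, e0]

/-- The shear has nowhere-vanishing vorticity. [folklore] -/
theorem curl_vShear_ne_zero (x : EuclideanSpace ℝ (Fin 3)) : curl vShear x ≠ 0 := by
  intro h
  have h2 := curl_vShear_two x
  rw [h] at h2
  simp at h2

/-- The shear is divergence free: `div (x₁, 0, 0) = ∂₀x₁ + ∂₁0 + ∂₂0 = 0` (divergence as the trace of
`Dv = shearL` in the standard orthonormal basis). [folklore] -/
theorem isDivFree_vShear : VectorCalculus.IsDivFree vShear := fun x => by
  rw [divergence_eq_sum_inner_fderiv (EuclideanSpace.basisFun (Fin 3) ℝ), fderiv_vShear]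
  simp [Fin.sum_univ_three, shearL, e0, EuclideanSpace.inner_single_left]

/-- `q` is the coordinate projection `proj 0`. [folklore] -/
theorem qLin_eq :
    qLin = ⇑(EuclideanSpace.proj (0 : Fin 3) : EuclideanSpace ℝ (Fin 3) →L[ℝ] ℝ) := rfl

/-- `q` is smooth. [folklore] -/
theorem contDiff_qLin : ContDiff ℝ ∞ qLin := by
  rw [qLin_eq]; exact ContinuousLinearMap.contDiff _

/-- `Dq(x) = proj 0` at every point. [folklore] -/
theorem fderiv_qLin (x : EuclideanSpace ℝ (Fin 3)) :
    fderiv ℝ qLin x = (EuclideanSpace.proj (0 : Fin 3) : EuclideanSpace ℝ (Fin 3) →L[ℝ] ℝ) := by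
  rw [qLin_eq]; exact ContinuousLinearMap.fderiv _

/-- `Δq = 0`: the second derivative of a linear map vanishes (Laplacian computed in the standard
orthonormal basis). [folklore] -/
theorem laplacian_qLin (x : EuclideanSpace ℝ (Fin 3)) : Δ qLin x = 0 := by
  rw [InnerProductSpace.laplacian_eq_iteratedFDeriv_stdOrthonormalBasis]
  simp only
  refine Finset.sum_eq_zero (fun i _ => ?_)
  rw [iteratedFDeriv_two_apply]
  have hf : fderiv ℝ qLin =
      fun _ => (EuclideanSpace.proj (0 : Fin 3) : EuclideanSpace ℝ (Fin 3) →L[ℝ] ℝ) := by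
    funext y; exact fderiv_qLin y
  rw [hf, fderiv_const_apply]
  simp

/-- The printed premise (4.7) holds for the witness with `θ ≡ 0`: `Δq = 0 = ⟪∇θ, curl v⟫` at every point
of `{curl v ≠ 0} = ℝ³`. [cite: Iotti2025UniformBound, Lemma 4.1, proof, display (4.7), p. 8] -/
theorem premise47_witness (x : EuclideanSpace ℝ (Fin 3)) :
    Δ qLin x = ⟪gradient (fun _ : EuclideanSpace ℝ (Fin 3) => (0 : ℝ)) x, curl vShear x⟫_ℝ := by
  rw [laplacian_qLin, gradient_fun_const, inner_zero_left]

/-- `∇q(0) ≠ 0` (indeed `∇q ≡ e₀`: `Dq = proj 0` does not vanish on `e₀`). [folklore] -/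
theorem gradient_qLin_zero_ne_zero : gradient qLin 0 ≠ 0 := by
  intro hzero
  unfold gradient at hzero
  rw [LinearIsometryEquiv.map_eq_zero_iff, fderiv_qLin] at hzero
  have h1 := congrArg (fun L : EuclideanSpace ℝ (Fin 3) →L[ℝ] ℝ => L e0) hzero
  simp [e0] at h1

/-- `a × 0 = 0` for the tree's cross product on `EuclideanSpace ℝ (Fin 3)`. [folklore] -/
theorem cross_zero_right (a : EuclideanSpace ℝ (Fin 3)) : cross a 0 = 0 := by
  simp [cross]

/-- The printed conclusion (4.8) fails for the witness at the origin: `∇q(0) ≠ v(0) × ∇θ(0)` (the right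
side is `v × 0 = 0`, the left side is `e₀`). [cite: Iotti2025UniformBound, Lemma 4.1, proof, display
(4.8), p. 8] -/
theorem conclusion48_fails :
    gradient qLin 0 ≠ cross (vShear 0) (gradient (fun _ : EuclideanSpace ℝ (Fin 3) => (0 : ℝ)) 0) := by
  rw [gradient_fun_const, cross_zero_right]
  exact gradient_qLin_zero_ne_zero

/-! ### The same failure with smooth, compactly supported fields

Decay does not rescue the inference: cutting the shear off smoothly outside a ball (velocity) and the linear
pressure off outside a larger ball leaves premise (4.7) intact on `{curl v ≠ 0}` and the failure of (4.8) at
the origin intact. (`θ ≡ 0` is trivially smooth and compactly supported.) -/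

/-- Smooth bump `χ` on `ℝ³`: `χ = 1` on the closed ball of radius `1`, `supp χ ⊆ ball 0 2`. [folklore] -/
def bump1 : ContDiffBump (0 : EuclideanSpace ℝ (Fin 3)) := ⟨1, 2, one_pos, one_lt_two⟩

/-- Smooth bump `ψ` on `ℝ³`: `ψ = 1` on the closed ball of radius `3`, `supp ψ ⊆ ball 0 4`. [folklore] -/
def bump3 : ContDiffBump (0 : EuclideanSpace ℝ (Fin 3)) := ⟨3, 4, by norm_num, by norm_num⟩

/-- Compactly supported smooth velocity `v_c = χ • (x₁, 0, 0)`. [folklore] -/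
def vComp : EuclideanSpace ℝ (Fin 3) → EuclideanSpace ℝ (Fin 3) := fun x => bump1 x • vShear x

/-- Compactly supported smooth pressure `q_c = ψ · x₀`. [folklore] -/
def qComp : EuclideanSpace ℝ (Fin 3) → ℝ := fun x => bump3 x * qLin x

/-- `v_c` is smooth. [folklore] -/
theorem contDiff_vComp : ContDiff ℝ ∞ vComp :=
  bump1.contDiff.smul (shearL.contDiff : ContDiff ℝ ∞ vShear)

/-- `q_c` is smooth. [folklore] -/
theorem contDiff_qComp : ContDiff ℝ ∞ qComp := bump3.contDiff.mul contDiff_qLin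

/-- `v_c` has compact support. [folklore] -/
theorem hasCompactSupport_vComp : HasCompactSupport vComp := bump1.hasCompactSupport.smul_right

/-- `q_c` has compact support. [folklore] -/
theorem hasCompactSupport_qComp : HasCompactSupport qComp := bump3.hasCompactSupport.mul_right

/-- Outside the closed ball of radius `2` the cut-off velocity vanishes identically near the point, so its
vorticity vanishes there. [folklore] -/
theorem curl_vComp_eq_zero {x : EuclideanSpace ℝ (Fin 3)} (hx : 2 < dist x 0) : curl vComp x = 0 := by
  have hev : vComp =ᶠ[𝓝 x] fun _ => 0 := by
    have ho : IsOpen {y : EuclideanSpace ℝ (Fin 3) | 2 < dist y 0} :=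
      isOpen_lt continuous_const (continuous_id.dist continuous_const)
    filter_upwards [ho.mem_nhds hx] with y hy
    simp only [vComp]
    rw [bump1.zero_of_le_dist (le_of_lt hy), zero_smul]
  have hD : fderiv ℝ vComp x = 0 := by
    rw [hev.fderiv_eq]; simp
  simp [curl, hD]

/-- Hence `curl v_c x ≠ 0` forces `dist x 0 ≤ 2`. [folklore] -/
theorem dist_le_of_curl_vComp_ne_zero {x : EuclideanSpace ℝ (Fin 3)} (hx : curl vComp x ≠ 0) :
    dist x 0 ≤ 2 := by
  by_contra h
  exact hx (curl_vComp_eq_zero (lt_of_not_ge h))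

/-- On the closed ball of radius `2` the cut-off pressure agrees with `x₀` near the point. [folklore] -/
theorem qComp_eventuallyEq {x : EuclideanSpace ℝ (Fin 3)} (hx : dist x 0 ≤ 2) :
    qComp =ᶠ[𝓝 x] qLin := by
  have hxb : x ∈ Metric.ball (0 : EuclideanSpace ℝ (Fin 3)) 3 := by
    rw [Metric.mem_ball]; linarith
  filter_upwards [Metric.isOpen_ball.mem_nhds hxb] with y hy
  have hy' : y ∈ Metric.closedBall (0 : EuclideanSpace ℝ (Fin 3)) bump3.rIn :=
    Metric.mem_closedBall.2 (le_of_lt (Metric.mem_ball.1 hy))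
  simp only [qComp]
  rw [bump3.one_of_mem_closedBall hy', one_mul]

/-- So `Δ q_c = 0` wherever `curl v_c ≠ 0`. [folklore] -/
theorem laplacian_qComp_eq_zero {x : EuclideanSpace ℝ (Fin 3)} (hx : curl vComp x ≠ 0) :
    Δ qComp x = 0 := by
  rw [(InnerProductSpace.laplacian_congr_nhds
    (qComp_eventuallyEq (dist_le_of_curl_vComp_ne_zero hx))).eq_of_nhds]
  exact laplacian_qLin x

/-- And `∇q_c(0) = ∇q(0)`. [folklore] -/
theorem gradient_qComp_zero : gradient qComp 0 = gradient qLin 0 := by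
  unfold gradient
  rw [(qComp_eventuallyEq (x := 0) (by simp)).fderiv_eq]

/-- Near the origin `v_c` is the shear itself, so `curl v_c 0 = curl v 0 ≠ 0`. [folklore] -/
theorem curl_vComp_zero_ne_zero : curl vComp 0 ≠ 0 := by
  have hev : vComp =ᶠ[𝓝 0] vShear := by
    filter_upwards [bump1.eventuallyEq_one] with y hy
    simp only [vComp, hy, Pi.one_apply, one_smul]
  have hD : fderiv ℝ vComp 0 = fderiv ℝ vShear 0 := hev.fderiv_eq
  have hc : curl vComp 0 = curl vShear 0 := by
    simp only [curl, hD]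
  rw [hc]
  exact curl_vShear_ne_zero 0

/-- **Decay does not rescue the device.** There are smooth, compactly supported fields `v, q` on `ℝ³`
(and `θ ≡ 0`) satisfying the printed premise (4.7) `Δq = ⟪∇θ, curl v⟫` at every point of `{curl v ≠ 0}`
for which the printed conclusion (4.8) `∇q = v × ∇θ` fails at a point of `{curl v ≠ 0}` (the origin).
[cite: Iotti2025UniformBound, Lemma 4.1, proof, (4.7) ⇒ (4.8), p. 8] -/
theorem device_fails_compactSupport :
    ∃ (v : EuclideanSpace ℝ (Fin 3) → EuclideanSpace ℝ (Fin 3)) (q : EuclideanSpace ℝ (Fin 3) → ℝ),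
      ContDiff ℝ ∞ v ∧ ContDiff ℝ ∞ q ∧ HasCompactSupport v ∧ HasCompactSupport q ∧
      (∀ x, curl v x ≠ 0 →
        Δ q x = ⟪gradient (fun _ : EuclideanSpace ℝ (Fin 3) => (0 : ℝ)) x, curl v x⟫_ℝ) ∧
      curl v 0 ≠ 0 ∧
      gradient q 0 ≠ cross (v 0) (gradient (fun _ : EuclideanSpace ℝ (Fin 3) => (0 : ℝ)) 0) := by
  refine ⟨vComp, qComp, contDiff_vComp, contDiff_qComp, hasCompactSupport_vComp,
    hasCompactSupport_qComp, fun x hx => ?_, curl_vComp_zero_ne_zero, ?_⟩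
  · rw [laplacian_qComp_eq_zero hx, gradient_fun_const, inner_zero_left]
  · rw [gradient_fun_const, cross_zero_right, gradient_qComp_zero]
    exact gradient_qLin_zero_ne_zero

end

/-- **C28b kill.** The device of Lemma 4.1 — from the scalar identity (4.7) `Δq = ∇θ·curl v` on
`{curl v ≠ 0}` to the vector identity (4.8) `∇q = v × ∇θ` there — is false at the printed grain:
witness `v = (x₁, 0, 0)`, `q = x₀`, `θ ≡ 0` (premise holds everywhere, conclusion fails at `0`).
Class: false lemma (countermodel). [cite: Iotti2025UniformBound, Lemma 4.1, proof, (4.7) ⇒ (4.8), p. 8] -/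
theorem not_Device_asPrinted : ¬ Literature.Claims.NS.Iotti2025.Device_asPrinted := by
  intro h
  exact conclusion48_fails
    (h vShear qLin (fun _ => 0) contDiff_vShear contDiff_qLin contDiffOn_const
      (fun x _ => premise47_witness x) 0 (curl_vShear_ne_zero 0))

/-- **The device stays false for divergence-free velocity fields** (the standing hypothesis
`div u = 0` of (1.1)/(1.2) does not rescue the inference (4.7) ⇒ (4.8)): the shear witness is
divergence free. Statement = `Device_asPrinted` with the extra hypothesis `IsDivFree v`, inlined.
[cite: Iotti2025UniformBound, Lemma 4.1, proof, (4.7) ⇒ (4.8), p. 8] -/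
theorem not_Device_divFree :
    ¬ (∀ (v : EuclideanSpace ℝ (Fin 3) → EuclideanSpace ℝ (Fin 3))
        (q θ : EuclideanSpace ℝ (Fin 3) → ℝ),
        ContDiff ℝ 2 v → VectorCalculus.IsDivFree v → ContDiff ℝ ∞ q →
        ContDiffOn ℝ 1 θ {x | curl v x ≠ 0} →
        (∀ x, curl v x ≠ 0 → Δ q x = ⟪gradient θ x, curl v x⟫_ℝ) →
        ∀ x, curl v x ≠ 0 → gradient q x = cross (v x) (gradient θ x)) := by
  intro h
  exact conclusion48_fails
    (h vShear qLin (fun _ => 0) contDiff_vShear isDivFree_vShear contDiff_qLin contDiffOn_const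
      (fun x _ => premise47_witness x) 0 (curl_vShear_ne_zero 0))

/-- **C28b kill, on-path name.** `Step_3b` (= `Device_asPrinted`, consumed by `step3_of_device` /
`claim_of_steps_device`) is false. [cite: Iotti2025UniformBound, Lemma 4.1, proof, (4.7) ⇒ (4.8), p. 8] -/
theorem not_Step_3b : ¬ Literature.Claims.NS.Iotti2025.Step_3b := not_Device_asPrinted

end Summit.NavierStokesRegularity.NavierStokesRegularity.Theorems.Iotti2025
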